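import Literature.MeasureTheory.Integral.L2ProdTensorTotal
import Literature.RepresentationTheory.Unitary.GramIsometryExtension
import HarnessLib

/-!
# Inner products of tensors and the AMPLIFICATIONS `U ⊗ 1`, `1 ⊗ V`, `π₁ ⊗ 1`, `1 ⊗ π₂` on `L²` of a product measure

Topic `MeasureTheory/Integral`; namespace `Literature.MeasureTheory.Integral`.  KERNEL ONLY: theorems; no definition, no
named fact, no `sorry`.  Continues `L2ProdTensorTotal.lean` (`f ⊗ g ∈ L²(μ ⊗ ν)`, totality of tensors).

* §1 **`inner_toLp_tensor`** — `⟪f ⊗ g, f' ⊗ g'⟫ = ⟪f, f'⟫ ⟪g, g'⟫` (Fubini, Mathlib `integral_prod_mul`).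
* §2 **`exists_linearIsometryEquiv_tensor_left/right`** — for a unitary `U` of `L²(μ)` there is a unitary `U ⊗ 1` of
  `L²(μ ⊗ ν)` with `(U ⊗ 1)(f ⊗ g) = U f ⊗ g`, unique among bounded operators (`clm_eq_of_forall_tensor`); the Gram
  matrices of `{f ⊗ g}` and `{U f ⊗ g}` agree by §1 and both families are total (`dense_span_tensor`), so the tree's
  Kolmogorov–GNS extension `Unitary.exists_linearIsometryEquiv_of_inner_eq` applies.  Same on the right.
* §3 **`exists_rep_tensor_left/right`** — a representation `π` of a group `G` on `L²(μ)` by linear isometries AMPLIFIES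
  to a representation `π ⊗ 1` of `G` on `L²(μ ⊗ ν)` by linear isometries with `(π ⊗ 1)(g)(f ⊗ h) = π(g) f ⊗ h`
  (multiplicativity from uniqueness on tensors); `tensor_left_comm_tensor_right` — `π₁ ⊗ 1` and `1 ⊗ π₂` commute;
  `continuous_of_continuous_tensor` — strong continuity of orbit maps passes from the factor to the amplification
  (continuity on the total set of tensors + isometries).

This is the Hilbert-space form of "`ρ = ρ_∞ ⊗ ρ_fin` on `L²(X_∞ × X_fin) = L²(X_∞) ⊗̂ L²(X_fin)`" for the adelic
Heisenberg representation [GelbartRogawski1991, §3.1 p. 454 L19–21], built WITHOUT a Hilbert tensor product: the two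
factors act on the one concrete space `L²(μ ⊗ ν)`.  [ReedSimon1980 = ReedSimonI1980, §II.4 and §VIII.10 (tensor products of
operators).]  Nothing of the cited sources is asserted; everything is proved.

## References
* [ReedSimonI1980] M. Reed, B. Simon, *Methods of Modern Mathematical Physics I* (1980), §II.4 Thm II.10, §VIII.10.
* [Dixmier1977] J. Dixmier, *C\*-algebras* (1977), Prop. 2.4.1 (ii) (uniqueness of the Kolmogorov/GNS space).
* [GelbartRogawski1991] S. Gelbart, J. Rogawski, Invent. Math. 105 (1991), §3.1 p. 454 L19–21.
-/

set_option autoImplicit false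

noncomputable section

open _root_.MeasureTheory _root_.MeasureTheory.Measure Set Filter
open scoped ENNReal Topology InnerProductSpace ComplexConjugate
open Literature.RepresentationTheory.Unitary (exists_linearIsometryEquiv_of_inner_eq continuousLinearMap_eq_of_eqOn_of_dense)

namespace Literature.MeasureTheory.Integral

variable {X Y : Type*} [MeasurableSpace X] [MeasurableSpace Y] (μ : Measure X) (ν : Measure Y)
  [SigmaFinite μ] [SigmaFinite ν]

/-! ## §1 Inner products of tensors -/

/-- **`⟪f ⊗ g, f' ⊗ g'⟫ = ⟪f, f'⟫ ⟪g, g'⟫`** in `L²(μ ⊗ ν)`. [cite: ReedSimonI1980, §II.4 Theorem II.10] -/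
theorem inner_toLp_tensor (f f' : Lp ℂ 2 μ) (g g' : Lp ℂ 2 ν) :
    ⟪(memLp_tensor_Lp μ ν f g).toLp _, (memLp_tensor_Lp μ ν f' g').toLp _⟫_ℂ = ⟪f, f'⟫_ℂ * ⟪g, g'⟫_ℂ := by
  rw [L2.inner_def, L2.inner_def, L2.inner_def, ← integral_prod_mul]
  refine integral_congr_ae ?_
  filter_upwards [(memLp_tensor_Lp μ ν f g).coeFn_toLp, (memLp_tensor_Lp μ ν f' g').coeFn_toLp] with z h1 h2
  rw [h1, h2]
  simp only [RCLike.inner_apply, map_mul]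
  ring

/-- the tensors `f ⊗ g`, `f ∈ L²(μ)`, `g ∈ L²(ν)`, are total in `L²(μ ⊗ ν)`. [cite: ReedSimonI1980, §II.4 Theorem II.10] -/
theorem dense_span_tensor_univ :
    Dense (Submodule.span ℂ (Set.range fun p : Lp ℂ 2 μ × Lp ℂ 2 ν => (memLp_tensor_Lp μ ν p.1 p.2).toLp _) :
      Set (Lp ℂ 2 (μ.prod ν))) :=
  dense_span_tensor μ ν (fun f : Lp ℂ 2 μ => f) (fun g : Lp ℂ 2 ν => g)
    (by rw [Set.range_id', Submodule.span_univ]; exact dense_univ)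
    (by rw [Set.range_id', Submodule.span_univ]; exact dense_univ)

/-- two bounded operators on `L²(μ ⊗ ν)` agreeing on all tensors are equal. [cite: ReedSimonI1980, §II.4 Theorem II.10] -/
theorem clm_eq_of_forall_tensor {F : Type*} [NormedAddCommGroup F] [InnerProductSpace ℂ F]
    (A B : Lp ℂ 2 (μ.prod ν) →L[ℂ] F)
    (h : ∀ (f : Lp ℂ 2 μ) (g : Lp ℂ 2 ν), A ((memLp_tensor_Lp μ ν f g).toLp _) = B ((memLp_tensor_Lp μ ν f g).toLp _)) :
    A = B :=
  continuousLinearMap_eq_of_eqOn_of_dense _ (dense_span_tensor_univ μ ν) A B fun p => h p.1 p.2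

/-! ## §2 Amplification of unitaries -/

/-- **`U ⊗ 1`**: a unitary `U` of `L²(μ)` amplifies to a unitary of `L²(μ ⊗ ν)` mapping `f ⊗ g ↦ U f ⊗ g`.
[cite: ReedSimonI1980, §VIII.10] -/
theorem exists_linearIsometryEquiv_tensor_left (U : Lp ℂ 2 μ ≃ₗᵢ[ℂ] Lp ℂ 2 μ) :
    ∃ T : Lp ℂ 2 (μ.prod ν) ≃ₗᵢ[ℂ] Lp ℂ 2 (μ.prod ν),
      ∀ (f : Lp ℂ 2 μ) (g : Lp ℂ 2 ν), T ((memLp_tensor_Lp μ ν f g).toLp _) = (memLp_tensor_Lp μ ν (U f) g).toLp _ := by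
  obtain ⟨T, hT⟩ := exists_linearIsometryEquiv_of_inner_eq
    (fun p : Lp ℂ 2 μ × Lp ℂ 2 ν => (memLp_tensor_Lp μ ν p.1 p.2).toLp _)
    (fun p : Lp ℂ 2 μ × Lp ℂ 2 ν => (memLp_tensor_Lp μ ν (U p.1) p.2).toLp _)
    (fun p q => by simp only [inner_toLp_tensor, LinearIsometryEquiv.inner_map_map])
    (dense_span_tensor_univ μ ν)
    (dense_span_tensor μ ν (fun f : Lp ℂ 2 μ => U f) (fun g : Lp ℂ 2 ν => g)
      (by rw [show Set.range (fun f : Lp ℂ 2 μ => U f) = Set.univ from U.surjective.range_eq, Submodule.span_univ]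
          exact dense_univ)
      (by rw [Set.range_id', Submodule.span_univ]; exact dense_univ))
  exact ⟨T, fun f g => hT (f, g)⟩

/-- **`1 ⊗ V`**: a unitary `V` of `L²(ν)` amplifies to a unitary of `L²(μ ⊗ ν)` mapping `f ⊗ g ↦ f ⊗ V g`.
[cite: ReedSimonI1980, §VIII.10] -/
theorem exists_linearIsometryEquiv_tensor_right (V : Lp ℂ 2 ν ≃ₗᵢ[ℂ] Lp ℂ 2 ν) :
    ∃ T : Lp ℂ 2 (μ.prod ν) ≃ₗᵢ[ℂ] Lp ℂ 2 (μ.prod ν),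
      ∀ (f : Lp ℂ 2 μ) (g : Lp ℂ 2 ν), T ((memLp_tensor_Lp μ ν f g).toLp _) = (memLp_tensor_Lp μ ν f (V g)).toLp _ := by
  obtain ⟨T, hT⟩ := exists_linearIsometryEquiv_of_inner_eq
    (fun p : Lp ℂ 2 μ × Lp ℂ 2 ν => (memLp_tensor_Lp μ ν p.1 p.2).toLp _)
    (fun p : Lp ℂ 2 μ × Lp ℂ 2 ν => (memLp_tensor_Lp μ ν p.1 (V p.2)).toLp _)
    (fun p q => by simp only [inner_toLp_tensor, LinearIsometryEquiv.inner_map_map])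
    (dense_span_tensor_univ μ ν)
    (dense_span_tensor μ ν (fun f : Lp ℂ 2 μ => f) (fun g : Lp ℂ 2 ν => V g)
      (by rw [Set.range_id', Submodule.span_univ]; exact dense_univ)
      (by rw [show Set.range (fun g : Lp ℂ 2 ν => V g) = Set.univ from V.surjective.range_eq, Submodule.span_univ]
          exact dense_univ))
  exact ⟨T, fun f g => hT (f, g)⟩

/-! ## §3 Amplification of isometric representations; commutation; strong continuity -/

section Rep

variable {G : Type*} [Group G]

/-- an isometric representation operator as a unitary (it is onto: `π g ∘ π g⁻¹ = 1`). [cite: Dixmier1977, §13.1.1] -/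
theorem exists_linearIsometryEquiv_eq_rep {E : Type*} [NormedAddCommGroup E] [InnerProductSpace ℂ E]
    (π : Representation ℂ G E) (hπ : ∀ (g : G) (v : E), ‖π g v‖ = ‖v‖) (g : G) :
    ∃ U : E ≃ₗᵢ[ℂ] E, ∀ v, U v = π g v := by
  refine ⟨{ toLinearEquiv := LinearEquiv.ofLinear (π g) (π g⁻¹) ?_ ?_, norm_map' := hπ g }, fun v => rfl⟩
  · rw [← Module.End.mul_eq_comp, ← map_mul, mul_inv_cancel, map_one]; rfl
  · rw [← Module.End.mul_eq_comp, ← map_mul, inv_mul_cancel, map_one]; rfl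

/-- **`π ⊗ 1`**: a representation `π` of `G` on `L²(μ)` by linear isometries amplifies to a representation of `G` on
`L²(μ ⊗ ν)` by linear isometries with `(π ⊗ 1)(g) (f ⊗ h) = π(g) f ⊗ h` (well defined and multiplicative because bounded
operators are determined by their values on tensors). [cite: ReedSimonI1980, §VIII.10] -/
theorem exists_rep_tensor_left (π : Representation ℂ G (Lp ℂ 2 μ)) (hπ : ∀ (g : G) (f : Lp ℂ 2 μ), ‖π g f‖ = ‖f‖) :
    ∃ Θ : Representation ℂ G (Lp ℂ 2 (μ.prod ν)),
      (∀ (g : G) (f : Lp ℂ 2 μ) (h : Lp ℂ 2 ν),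
        Θ g ((memLp_tensor_Lp μ ν f h).toLp _) = (memLp_tensor_Lp μ ν (π g f) h).toLp _) ∧
      ∀ (g : G) (F : Lp ℂ 2 (μ.prod ν)), ‖Θ g F‖ = ‖F‖ := by
  -- choose the amplified unitaries
  have hex : ∀ g : G, ∃ T : Lp ℂ 2 (μ.prod ν) ≃ₗᵢ[ℂ] Lp ℂ 2 (μ.prod ν),
      ∀ (f : Lp ℂ 2 μ) (h : Lp ℂ 2 ν), T ((memLp_tensor_Lp μ ν f h).toLp _) = (memLp_tensor_Lp μ ν (π g f) h).toLp _ := by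
    intro g
    obtain ⟨U, hU⟩ := exists_linearIsometryEquiv_eq_rep π hπ g
    obtain ⟨T, hT⟩ := exists_linearIsometryEquiv_tensor_left μ ν U
    exact ⟨T, fun f h => by rw [hT, hU]⟩
  choose T hT using hex
  have hone : (T 1 : Lp ℂ 2 (μ.prod ν) →L[ℂ] Lp ℂ 2 (μ.prod ν)) = ContinuousLinearMap.id ℂ _ :=
    clm_eq_of_forall_tensor μ ν _ _ fun f h => by
      change T 1 _ = _
      rw [hT, map_one, Module.End.one_apply, ContinuousLinearMap.id_apply]
  have hmul : ∀ g g' : G, (T (g * g') : Lp ℂ 2 (μ.prod ν) →L[ℂ] Lp ℂ 2 (μ.prod ν)) =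
      (T g : Lp ℂ 2 (μ.prod ν) →L[ℂ] _).comp (T g' : Lp ℂ 2 (μ.prod ν) →L[ℂ] _) := fun g g' =>
    clm_eq_of_forall_tensor μ ν _ _ fun f h => by
      change T (g * g') _ = T g (T g' _)
      rw [hT, hT, hT, map_mul, Module.End.mul_apply]
  refine ⟨{ toFun := fun g => ((T g : Lp ℂ 2 (μ.prod ν) →L[ℂ] Lp ℂ 2 (μ.prod ν)) : Lp ℂ 2 (μ.prod ν) →ₗ[ℂ] _)
            map_one' := by rw [hone]; rfl
            map_mul' := fun g g' => by rw [hmul]; rfl }, fun g f h => hT g f h, fun g F => (T g).norm_map F⟩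

/-- **`1 ⊗ π`**: the same on the right factor. [cite: ReedSimonI1980, §VIII.10] -/
theorem exists_rep_tensor_right (π : Representation ℂ G (Lp ℂ 2 ν)) (hπ : ∀ (g : G) (f : Lp ℂ 2 ν), ‖π g f‖ = ‖f‖) :
    ∃ Θ : Representation ℂ G (Lp ℂ 2 (μ.prod ν)),
      (∀ (g : G) (f : Lp ℂ 2 μ) (h : Lp ℂ 2 ν),
        Θ g ((memLp_tensor_Lp μ ν f h).toLp _) = (memLp_tensor_Lp μ ν f (π g h)).toLp _) ∧
      ∀ (g : G) (F : Lp ℂ 2 (μ.prod ν)), ‖Θ g F‖ = ‖F‖ := by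
  have hex : ∀ g : G, ∃ T : Lp ℂ 2 (μ.prod ν) ≃ₗᵢ[ℂ] Lp ℂ 2 (μ.prod ν),
      ∀ (f : Lp ℂ 2 μ) (h : Lp ℂ 2 ν), T ((memLp_tensor_Lp μ ν f h).toLp _) = (memLp_tensor_Lp μ ν f (π g h)).toLp _ := by
    intro g
    obtain ⟨U, hU⟩ := exists_linearIsometryEquiv_eq_rep π hπ g
    obtain ⟨T, hT⟩ := exists_linearIsometryEquiv_tensor_right μ ν U
    exact ⟨T, fun f h => by rw [hT, hU]⟩
  choose T hT using hex
  have hone : (T 1 : Lp ℂ 2 (μ.prod ν) →L[ℂ] Lp ℂ 2 (μ.prod ν)) = ContinuousLinearMap.id ℂ _ :=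
    clm_eq_of_forall_tensor μ ν _ _ fun f h => by
      change T 1 _ = _
      rw [hT, map_one, Module.End.one_apply, ContinuousLinearMap.id_apply]
  have hmul : ∀ g g' : G, (T (g * g') : Lp ℂ 2 (μ.prod ν) →L[ℂ] Lp ℂ 2 (μ.prod ν)) =
      (T g : Lp ℂ 2 (μ.prod ν) →L[ℂ] _).comp (T g' : Lp ℂ 2 (μ.prod ν) →L[ℂ] _) := fun g g' =>
    clm_eq_of_forall_tensor μ ν _ _ fun f h => by
      change T (g * g') _ = T g (T g' _)
      rw [hT, hT, hT, map_mul, Module.End.mul_apply]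
  refine ⟨{ toFun := fun g => ((T g : Lp ℂ 2 (μ.prod ν) →L[ℂ] Lp ℂ 2 (μ.prod ν)) : Lp ℂ 2 (μ.prod ν) →ₗ[ℂ] _)
            map_one' := by rw [hone]; rfl
            map_mul' := fun g g' => by rw [hmul]; rfl }, fun g f h => hT g f h, fun g F => (T g).norm_map F⟩

/-- an isometric linear map as a bounded operator (for uniqueness arguments). [cite: Dixmier1977, §13.1.1] -/
theorem exists_clm_eq_of_norm_eq {E : Type*} [NormedAddCommGroup E] [InnerProductSpace ℂ E] (A : E →ₗ[ℂ] E)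
    (hA : ∀ v, ‖A v‖ = ‖v‖) : ∃ T : E →L[ℂ] E, ∀ v, T v = A v :=
  ⟨A.mkContinuous 1 fun v => by rw [hA, one_mul], fun _ => rfl⟩

/-- **`(π₁ ⊗ 1)` and `(1 ⊗ π₂)` commute** (both composites send `f ⊗ h ↦ π₁(g₁) f ⊗ π₂(g₂) h`).
[cite: ReedSimonI1980, §VIII.10] -/
theorem tensor_left_comm_tensor_right {G₁ G₂ : Type*} [Group G₁] [Group G₂]
    {π₁ : Representation ℂ G₁ (Lp ℂ 2 μ)} {π₂ : Representation ℂ G₂ (Lp ℂ 2 ν)}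
    (Θ₁ : Representation ℂ G₁ (Lp ℂ 2 (μ.prod ν))) (Θ₂ : Representation ℂ G₂ (Lp ℂ 2 (μ.prod ν)))
    (h₁ : ∀ (g : G₁) (f : Lp ℂ 2 μ) (h : Lp ℂ 2 ν),
      Θ₁ g ((memLp_tensor_Lp μ ν f h).toLp _) = (memLp_tensor_Lp μ ν (π₁ g f) h).toLp _)
    (h₁u : ∀ (g : G₁) (F : Lp ℂ 2 (μ.prod ν)), ‖Θ₁ g F‖ = ‖F‖)
    (h₂ : ∀ (g : G₂) (f : Lp ℂ 2 μ) (h : Lp ℂ 2 ν),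
      Θ₂ g ((memLp_tensor_Lp μ ν f h).toLp _) = (memLp_tensor_Lp μ ν f (π₂ g h)).toLp _)
    (h₂u : ∀ (g : G₂) (F : Lp ℂ 2 (μ.prod ν)), ‖Θ₂ g F‖ = ‖F‖) (g₁ : G₁) (g₂ : G₂) (F : Lp ℂ 2 (μ.prod ν)) :
    Θ₁ g₁ (Θ₂ g₂ F) = Θ₂ g₂ (Θ₁ g₁ F) := by
  obtain ⟨A, hA⟩ := exists_clm_eq_of_norm_eq (Θ₁ g₁) (h₁u g₁)
  obtain ⟨B, hB⟩ := exists_clm_eq_of_norm_eq (Θ₂ g₂) (h₂u g₂)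
  have h := clm_eq_of_forall_tensor μ ν (A.comp B) (B.comp A) fun f h => by
    simp only [ContinuousLinearMap.comp_apply, hA, hB, h₁, h₂]
  have := congrArg (fun T : Lp ℂ 2 (μ.prod ν) →L[ℂ] Lp ℂ 2 (μ.prod ν) => T F) h
  simpa only [ContinuousLinearMap.comp_apply, hA, hB] using this

/-- **strong continuity passes to the amplification**: if `t ↦ A t v` is continuous for every `v` in a family with dense
span and every `A t` is a linear isometry, then `t ↦ A t v` is continuous for every `v` (uniform approximation).
[cite: ReedSimonI1980, §VIII.10] -/
theorem continuous_apply_of_dense {T : Type*} [TopologicalSpace T] {E : Type*} [NormedAddCommGroup E]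
    [InnerProductSpace ℂ E] {ι : Type*} (e : ι → E) (he : Dense (Submodule.span ℂ (Set.range e) : Set E))
    (A : T → E →ₗ[ℂ] E) (hA : ∀ (t : T) (v : E), ‖A t v‖ = ‖v‖) (hc : ∀ i, Continuous fun t => A t (e i)) (v : E) :
    Continuous fun t => A t v := by
  -- the set of good vectors is a closed submodule containing the `e i`
  let K : Submodule ℂ E :=
    { carrier := {v | Continuous fun t => A t v}
      add_mem' := fun {u w} hu hw => by
        change Continuous fun t => A t (u + w)
        simp only [map_add]
        exact Continuous.add hu hw
      zero_mem' := by
        change Continuous fun t => A t 0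
        simp only [map_zero]
        exact continuous_const
      smul_mem' := fun c {u} hu => by
        change Continuous fun t => A t (c • u)
        simp only [map_smul]
        exact Continuous.const_smul hu c }
  have hKc : IsClosed (K : Set E) := by
    refine isClosed_of_closure_subset fun w hw => ?_
    change Continuous fun t => A t w
    refine continuous_iff_continuousAt.2 fun t₀ => ?_
    rw [ContinuousAt, Metric.tendsto_nhds]
    intro ε hε
    obtain ⟨u, hu, huw⟩ := Metric.mem_closure_iff.1 hw (ε / 3) (by positivity)
    have huc : Continuous fun t => A t u := hu
    have hev : ∀ᶠ t in 𝓝 t₀, dist (A t u) (A t₀ u) < ε / 3 :=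
      Metric.tendsto_nhds.1 (huc.tendsto t₀) _ (by positivity)
    filter_upwards [hev] with t ht
    calc dist (A t w) (A t₀ w)
        ≤ dist (A t w) (A t u) + dist (A t u) (A t₀ u) + dist (A t₀ u) (A t₀ w) := dist_triangle4 _ _ _ _
      _ < ε / 3 + ε / 3 + ε / 3 := by
          gcongr
          · rw [dist_eq_norm, ← map_sub, hA, ← dist_eq_norm]; exact huw
          · rw [dist_eq_norm, ← map_sub, hA, ← dist_eq_norm, dist_comm]; exact huw
      _ = ε := by ring
  have hle : Submodule.span ℂ (Set.range e) ≤ K := Submodule.span_le.2 (Set.range_subset_iff.2 fun i => hc i)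
  have hK : K = ⊤ := by
    have hcl : (Submodule.span ℂ (Set.range e)).topologicalClosure ≤ K := by
      rw [← hKc.submodule_topologicalClosure_eq]; exact Submodule.topologicalClosure_mono hle
    rw [Submodule.dense_iff_topologicalClosure_eq_top] at he
    rw [he] at hcl
    exact top_le_iff.1 hcl
  have hv : v ∈ K := by rw [hK]; exact Submodule.mem_top
  exact hv

/-- strong continuity of `π ⊗ 1` from that of `π`: if `t ↦ π(c t) f` is continuous for all `f` along a map `c : T → G`,
so is `t ↦ (π ⊗ 1)(c t) F` for all `F`. [cite: ReedSimonI1980, §VIII.10] -/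
theorem continuous_rep_tensor_left_apply {T : Type*} [TopologicalSpace T] {π : Representation ℂ G (Lp ℂ 2 μ)}
    (Θ : Representation ℂ G (Lp ℂ 2 (μ.prod ν)))
    (hΘ : ∀ (g : G) (f : Lp ℂ 2 μ) (h : Lp ℂ 2 ν),
      Θ g ((memLp_tensor_Lp μ ν f h).toLp _) = (memLp_tensor_Lp μ ν (π g f) h).toLp _)
    (hΘu : ∀ (g : G) (F : Lp ℂ 2 (μ.prod ν)), ‖Θ g F‖ = ‖F‖) (c : T → G)
    (hc : ∀ f : Lp ℂ 2 μ, Continuous fun t => π (c t) f) (F : Lp ℂ 2 (μ.prod ν)) :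
    Continuous fun t => Θ (c t) F := by
  refine continuous_apply_of_dense (fun p : Lp ℂ 2 μ × Lp ℂ 2 ν => (memLp_tensor_Lp μ ν p.1 p.2).toLp _)
    (dense_span_tensor_univ μ ν) (fun t => Θ (c t)) (fun t F => hΘu (c t) F) (fun p => ?_) F
  obtain ⟨S, hS⟩ := exists_clm_tensor_left μ ν p.2
  have e : (fun t => Θ (c t) ((memLp_tensor_Lp μ ν p.1 p.2).toLp _)) = fun t => S (π (c t) p.1) := by
    funext t; rw [hΘ, hS]
  rw [e]
  exact S.continuous.comp (hc p.1)

/-- strong continuity of `1 ⊗ π` from that of `π`. [cite: ReedSimonI1980, §VIII.10] -/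
theorem continuous_rep_tensor_right_apply {T : Type*} [TopologicalSpace T] {π : Representation ℂ G (Lp ℂ 2 ν)}
    (Θ : Representation ℂ G (Lp ℂ 2 (μ.prod ν)))
    (hΘ : ∀ (g : G) (f : Lp ℂ 2 μ) (h : Lp ℂ 2 ν),
      Θ g ((memLp_tensor_Lp μ ν f h).toLp _) = (memLp_tensor_Lp μ ν f (π g h)).toLp _)
    (hΘu : ∀ (g : G) (F : Lp ℂ 2 (μ.prod ν)), ‖Θ g F‖ = ‖F‖) (c : T → G)
    (hc : ∀ h : Lp ℂ 2 ν, Continuous fun t => π (c t) h) (F : Lp ℂ 2 (μ.prod ν)) :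
    Continuous fun t => Θ (c t) F := by
  refine continuous_apply_of_dense (fun p : Lp ℂ 2 μ × Lp ℂ 2 ν => (memLp_tensor_Lp μ ν p.1 p.2).toLp _)
    (dense_span_tensor_univ μ ν) (fun t => Θ (c t)) (fun t F => hΘu (c t) F) (fun p => ?_) F
  obtain ⟨S, hS⟩ := exists_clm_tensor_right μ ν p.1
  have e : (fun t => Θ (c t) ((memLp_tensor_Lp μ ν p.1 p.2).toLp _)) = fun t => S (π (c t) p.2) := by
    funext t; rw [hΘ, hS]
  rw [e]
  exact S.continuous.comp (hc p.2)

end Rep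

end Literature.MeasureTheory.Integral

end
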